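import Summits.BirchSwinnertonDyer.BirchSwinnertonDyer.Theorems.SignedBaseChangeAnticyclotomicEisensteinDivisibilitySpecializationLength
import Mathlib.RingTheory.PowerSeries.NoZeroDivisors
import Mathlib.RingTheory.Ideal.KrullsHeightTheorem
import HarnessLib

/-!
# Specialisation `X ↦ 0` of characteristic ideals over `A⟦X⟧`: cyclic modules and the principal
# generator (proofs)

Helper file (--supports stmt-BirchSwinnertonDyer-20727); second of three files on the specialisation of the tree's
characteristic ideal (`Module.charIdeal`) along `π = constantCoeff : A⟦X⟧ → A` (companion of
`SignedBaseChangeAnticyclotomicEisensteinDivisibilitySpecializationLength.lean`, consumed by `SignedBaseChangeAnticyclotomicEisensteinDivisibilitySpecializationHerbrand.lean`).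
For a commutative ring `A` (Noetherian domain where needed) and an `A⟦X⟧`-module `N` with a compatible
`A`-structure (`[Module A N] [IsScalarTower A A⟦X⟧ N]`, the algebra structure being Mathlib's constants
`C : A → A⟦X⟧` for an abstract `A`), writing `N/XN = QuotSMulTop X N`, `N[X] = Submodule.torsionBy`:

* `constantCoeff` is a retraction of `C` with kernel `(X)`; `ker π` kills `N/XN` and `N[X]`, so these are
  finitely generated `A`-modules killed by `s(0)` whenever `s` kills `N`
  (`moduleFinite_quotSMulTop`, `moduleFinite_torsionBy`, `isTorsionBy_constantCoeff`);
* the cyclic modules `A⟦X⟧/𝔭`: `(A⟦X⟧/𝔭)[X] = 0` or everything, `(A⟦X⟧/I)/X ≃ₗ[A] A/I(0)`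
  (`nonempty_quotSMulTop_quotient_linearEquiv`), the height bound `ht {r : r(0) ∈ 𝔮} ≤ 2` for a
  height-one `𝔮 ⊂ A` (Krull, Mathlib `Ideal.height_le_height_add_one_of_mem`), and the resulting
  **cyclic case of the local Herbrand formula** `lengthAt_cyclic`:
  `ℓ_𝔮((A⟦X⟧/𝔭)/X) = ℓ_𝔮((A⟦X⟧/𝔭)[X]) + ℓ_𝔮(A/char(A⟦X⟧/𝔭)(0))` for `𝔭 ≠ 0, (X)`;
* for `A⟦X⟧` factorial: the characteristic ideal of a module killed by some `s` with `s(0) ≠ 0` is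
  principal with generator `F`, `F(0) ≠ 0` (`exists_charIdeal_eq_span`), and `ℓ_𝔮(A/char(·)(0))` is
  additive in short exact sequences (`lengthAt_quotient_map_charIdeal_eq_add`; multiplicativity of
  `charIdeal`, tree `charIdeal_eq_mul_of_exact`, Bourbaki AC VII §4.5 Prop. 10).

Theorems only; [folklore] commutative algebra (Bourbaki AC VII §4; the one-variable case `A = ℤ_p` is
the `Γ`-Euler-characteristic computation of the tree's `IwasawaEulerCharProofs.lean`). Written for the
lead-prover seat of stmt-BirchSwinnertonDyer-20727 (stub S2); nothing about elliptic curves is asserted.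

## References

* N. Bourbaki, *Algèbre commutative*, Ch. VII §4.4–4.5.
* R. Greenberg, *Iwasawa theory for elliptic curves*, LNM 1716 (1999), §4. [GreenbergLNM1716]
-/

noncomputable section

open Function
open scoped Pointwise

-- D-0017: single-problem summit, the namespace repeats the problem name by design.
set_option linter.dupNamespace false
set_option autoImplicit false

namespace Summit.BirchSwinnertonDyer.BirchSwinnertonDyer.Theorems.SignedBaseChangeAcDivSpecialization

open Literature.NumberTheory.EllipticCurves Literature.NumberTheory.EllipticCurves.Module

namespace PowerSeriesSpecialization

open LocalLength PowerSeries

universe u v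

variable {A : Type u} [CommRing A]

/-! ### The retraction `constantCoeff : A⟦X⟧ → A` -/

/-- `constantCoeff ∘ C = id`. [folklore] -/
theorem constantCoeff_algebraMap (a : A) :
    PowerSeries.constantCoeff (algebraMap A (PowerSeries A) a) = a := by
  rw [← PowerSeries.C_eq_algebraMap, PowerSeries.constantCoeff_C]

/-- `ker (X ↦ 0) = (X)`. [folklore] -/
theorem ker_constantCoeff_eq_span_X :
    RingHom.ker (PowerSeries.constantCoeff (R := A)) = Ideal.span {(X : PowerSeries A)} := by
  ext φ
  rw [RingHom.mem_ker, Ideal.mem_span_singleton, PowerSeries.X_dvd_iff]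

/-- `r ∈ (X)` iff `r(0) = 0`. [folklore] -/
theorem mem_span_X_iff {r : PowerSeries A} :
    r ∈ Ideal.span {(X : PowerSeries A)} ↔ PowerSeries.constantCoeff r = 0 := by
  rw [Ideal.mem_span_singleton, PowerSeries.X_dvd_iff]

/-- The image of an ideal under `X ↦ 0` pulls back to `I + (X)`. [folklore] -/
theorem comap_map_constantCoeff (I : Ideal (PowerSeries A)) :
    (I.map (PowerSeries.constantCoeff (R := A))).comap (PowerSeries.constantCoeff (R := A)) =
      I ⊔ Ideal.span {(X : PowerSeries A)} := by
  rw [Ideal.comap_map_of_surjective _ PowerSeries.constantCoeff_surj, ← RingHom.ker_eq_comap_bot,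
    ker_constantCoeff_eq_span_X]

variable {N : Type v} [AddCommGroup N] [Module (PowerSeries A) N]

/-- `ker (X ↦ 0)` kills `N/XN`. [folklore] -/
theorem smul_quotSMulTop_eq_zero (r : PowerSeries A) (m : QuotSMulTop (X : PowerSeries A) N)
    (hr : PowerSeries.constantCoeff r = 0) : r • m = 0 := by
  obtain ⟨r', rfl⟩ := PowerSeries.X_dvd_iff.mpr hr
  obtain ⟨n, rfl⟩ := Submodule.Quotient.mk_surjective _ m
  have h : (X * r') • (Submodule.Quotient.mk n : QuotSMulTop (X : PowerSeries A) N) =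
      Submodule.Quotient.mk ((X : PowerSeries A) • (r' • n)) := by
    rw [← mul_smul, Submodule.Quotient.mk_smul]
  rw [h, Submodule.Quotient.mk_eq_zero]
  exact Submodule.smul_mem_pointwise_smul _ _ _ Submodule.mem_top

/-- `ker (X ↦ 0)` kills `N[X]`. [folklore] -/
theorem smul_torsionBy_eq_zero (r : PowerSeries A)
    (m : Submodule.torsionBy (PowerSeries A) N (X : PowerSeries A))
    (hr : PowerSeries.constantCoeff r = 0) : r • m = 0 := by
  obtain ⟨r', rfl⟩ := PowerSeries.X_dvd_iff.mpr hr
  apply Subtype.ext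
  rw [Submodule.coe_smul, Submodule.coe_zero, mul_comm, mul_smul]
  have := (Submodule.mem_torsionBy_iff (X : PowerSeries A) (m : N)).mp m.2
  rw [this, smul_zero]

section WithA

variable [Module A N] [IsScalarTower A (PowerSeries A) N]

/-- `N/XN` is finitely generated over `A` when `N` is finitely generated over `A⟦X⟧`. [folklore] -/
theorem moduleFinite_quotSMulTop [Module.Finite (PowerSeries A) N] :
    Module.Finite A (QuotSMulTop (X : PowerSeries A) N) :=
  moduleFinite_of_retraction (PowerSeries.constantCoeff (R := A)) constantCoeff_algebraMap
    (smul_quotSMulTop_eq_zero (N := N))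

/-- `N[X]` is finitely generated over `A` when `N` is finitely generated over a Noetherian `A⟦X⟧`.
[folklore] -/
theorem moduleFinite_torsionBy [IsNoetherianRing A] [Module.Finite (PowerSeries A) N] :
    Module.Finite A (Submodule.torsionBy (PowerSeries A) N (X : PowerSeries A)) := by
  haveI : IsNoetherian (PowerSeries A) N := isNoetherian_of_isNoetherianRing_of_finite _ _
  exact moduleFinite_of_retraction (PowerSeries.constantCoeff (R := A)) constantCoeff_algebraMap
    (smul_torsionBy_eq_zero (N := N))

/-- If `s ∈ A⟦X⟧` kills `N` then `s(0)` kills `N/XN` and `N[X]`. [folklore] -/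
theorem isTorsionBy_constantCoeff {s : PowerSeries A} (hs : ∀ m : N, s • m = 0) :
    Module.IsTorsionBy A (QuotSMulTop (X : PowerSeries A) N) (PowerSeries.constantCoeff s) ∧
      Module.IsTorsionBy A (Submodule.torsionBy (PowerSeries A) N (X : PowerSeries A))
        (PowerSeries.constantCoeff s) := by
  constructor
  · refine isTorsionBy_map_of_retraction _ constantCoeff_algebraMap
      (smul_quotSMulTop_eq_zero (N := N)) fun m => ?_
    obtain ⟨n, rfl⟩ := Submodule.Quotient.mk_surjective _ m
    rw [← Submodule.Quotient.mk_smul, hs, Submodule.Quotient.mk_zero]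
  · refine isTorsionBy_map_of_retraction _ constantCoeff_algebraMap
      (smul_torsionBy_eq_zero (N := N)) fun m => Subtype.ext ?_
    rw [Submodule.coe_smul, hs, Submodule.coe_zero]

end WithA

/-! ### Cyclic modules `A⟦X⟧/𝔭` -/

section Cyclic

/-- If `X ∉ I` with `I` prime then `(A⟦X⟧/I)[X] = 0`. [folklore] -/
theorem torsionBy_quotient_eq_bot {I : Ideal (PowerSeries A)} [I.IsPrime]
    (hX : (X : PowerSeries A) ∉ I) :
    Submodule.torsionBy (PowerSeries A) (PowerSeries A ⧸ I) (X : PowerSeries A) = ⊥ := by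
  rw [eq_bot_iff]
  intro y hy
  obtain ⟨a, rfl⟩ := Ideal.Quotient.mk_surjective y
  rw [Submodule.mem_torsionBy_iff] at hy
  change Ideal.Quotient.mk I (X * a) = 0 at hy
  rw [Ideal.Quotient.eq_zero_iff_mem] at hy
  rw [Submodule.mem_bot, Ideal.Quotient.eq_zero_iff_mem]
  exact ((‹I.IsPrime›).mem_or_mem hy).resolve_left hX

/-- If `X ∈ I` then `(A⟦X⟧/I)[X]` is everything. [folklore] -/
theorem torsionBy_quotient_eq_top {I : Ideal (PowerSeries A)} (hX : (X : PowerSeries A) ∈ I) :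
    Submodule.torsionBy (PowerSeries A) (PowerSeries A ⧸ I) (X : PowerSeries A) = ⊤ := by
  rw [eq_top_iff]
  intro y _
  obtain ⟨a, rfl⟩ := Ideal.Quotient.mk_surjective y
  rw [Submodule.mem_torsionBy_iff]
  change Ideal.Quotient.mk I (X * a) = 0
  rw [Ideal.Quotient.eq_zero_iff_mem]
  exact I.mul_mem_right _ hX

/-- If `X ∈ I` then `X · (A⟦X⟧/I) = 0`. [folklore] -/
theorem smul_top_quotient_eq_bot {I : Ideal (PowerSeries A)} (hX : (X : PowerSeries A) ∈ I) :
    ((X : PowerSeries A) • ⊤ : Submodule (PowerSeries A) (PowerSeries A ⧸ I)) = ⊥ := by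
  rw [eq_bot_iff]
  intro y hy
  obtain ⟨z, -, rfl⟩ := (Submodule.mem_smul_pointwise_iff_exists _ _ _).mp hy
  obtain ⟨a, rfl⟩ := Ideal.Quotient.mk_surjective z
  rw [Submodule.mem_bot]
  change Ideal.Quotient.mk I (X * a) = 0
  rw [Ideal.Quotient.eq_zero_iff_mem]
  exact I.mul_mem_right _ hX

/-- `X · (A⟦X⟧/I) = ((X) + I)/I`. [folklore] -/
theorem smul_top_quotient_eq_map (I : Ideal (PowerSeries A)) :
    ((X : PowerSeries A) • ⊤ : Submodule (PowerSeries A) (PowerSeries A ⧸ I)) =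
      Submodule.map (Submodule.mkQ I) (Ideal.span {(X : PowerSeries A)}) := by
  ext y
  rw [Submodule.mem_smul_pointwise_iff_exists, Submodule.mem_map]
  constructor
  · rintro ⟨z, -, rfl⟩
    obtain ⟨a, rfl⟩ := Submodule.Quotient.mk_surjective I z
    exact ⟨X * a, Ideal.mem_span_singleton'.mpr ⟨a, mul_comm _ _⟩, rfl⟩
  · rintro ⟨h, hh, rfl⟩
    obtain ⟨a, rfl⟩ := Ideal.mem_span_singleton'.mp hh
    exact ⟨Submodule.Quotient.mk a, Submodule.mem_top, by
      rw [Submodule.mkQ_apply, mul_comm, ← smul_eq_mul, Submodule.Quotient.mk_smul]⟩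

/-- `A⟦X⟧/(I + (X)) ≃ A/I(0)` as `A`-modules (`I(0)` the image of `I` under `X ↦ 0`): the
`A`-algebra map `A⟦X⟧ → A → A/I(0)` is onto with kernel `I + (X)`. [folklore] -/
theorem nonempty_quotient_sup_span_X_linearEquiv (I : Ideal (PowerSeries A)) :
    Nonempty ((PowerSeries A ⧸ (I ⊔ Ideal.span {(X : PowerSeries A)})) ≃ₗ[A]
      (A ⧸ I.map (PowerSeries.constantCoeff (R := A)))) := by
  let cc : PowerSeries A →ₐ[A] A :=
    { PowerSeries.constantCoeff (R := A) with commutes' := constantCoeff_algebraMap }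
  let φ : PowerSeries A →ₐ[A] A ⧸ I.map (PowerSeries.constantCoeff (R := A)) :=
    (Ideal.Quotient.mkₐ A _).comp cc
  have hφ : Function.Surjective φ :=
    (Ideal.Quotient.mkₐ_surjective A _).comp PowerSeries.constantCoeff_surj
  have hker : RingHom.ker φ = I ⊔ Ideal.span {(X : PowerSeries A)} := by
    rw [← comap_map_constantCoeff I]
    ext r
    simp only [RingHom.mem_ker, Ideal.mem_comap]
    exact Ideal.Quotient.eq_zero_iff_mem
  exact ⟨(Ideal.quotientEquivAlgOfEq A hker.symm).toLinearEquiv ≪≫ₗ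
    (Ideal.quotientKerAlgEquivOfSurjective hφ).toLinearEquiv⟩

/-- `(A⟦X⟧/I)/X ≃ A/I(0)` as `A`-modules (through `A⟦X⟧/(I + (X))`). [folklore] -/
theorem nonempty_quotSMulTop_quotient_linearEquiv (I : Ideal (PowerSeries A)) :
    Nonempty (QuotSMulTop (X : PowerSeries A) (PowerSeries A ⧸ I) ≃ₗ[A]
      (A ⧸ I.map (PowerSeries.constantCoeff (R := A)))) := by
  obtain ⟨e⟩ := nonempty_quotient_sup_span_X_linearEquiv I
  exact ⟨((Submodule.quotEquivOfEq _ _ (smul_top_quotient_eq_map I)) ≪≫ₗ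
    Submodule.quotientQuotientEquivQuotientSup I (Ideal.span {(X : PowerSeries A)})).restrictScalars A
      ≪≫ₗ e⟩

/-- Quotients by equal ideals have the same local lengths. [folklore] -/
theorem lengthAt_quotient_congr {I J : Ideal A} (h : I = J) (𝔮 : PrimeSpectrum A) :
    lengthAt A (A ⧸ I) 𝔮 = lengthAt A (A ⧸ J) 𝔮 :=
  lengthAt_eq_of_linearEquiv (Submodule.quotEquivOfEq I J h) 𝔮

/-- `A/⊤` has length `0` everywhere. [folklore] -/
theorem lengthAt_quotient_top (𝔮 : PrimeSpectrum A) : lengthAt A (A ⧸ (⊤ : Ideal A)) 𝔮 = 0 :=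
  lengthAt_quotient_eq_zero_of_not_le fun h => 𝔮.isPrime.ne_top (top_le_iff.mp h)

variable [IsDomain A] [IsNoetherianRing A]

/-- `(X) ⊂ A⟦X⟧` has height one. [folklore] -/
theorem height_span_X : (Ideal.span {(X : PowerSeries A)}).height = 1 :=
  height_span_singleton_eq_one_of_prime PowerSeries.X_prime

omit [IsDomain A] in
/-- The pull-back `Q = {r : r(0) ∈ 𝔮}` of a height-one prime `𝔮 ⊂ A` has height `≤ 2` in `A⟦X⟧`
(`Q ∋ X` and `Q/(X) ≅ 𝔮` under `A⟦X⟧/(X) ≅ A`). [folklore] -/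
theorem height_comap_constantCoeff_le (𝔮 : PrimeSpectrum A) (h𝔮 : 𝔮.asIdeal.height = 1) :
    (𝔮.asIdeal.comap (PowerSeries.constantCoeff (R := A))).height ≤ 2 := by
  set Q := 𝔮.asIdeal.comap (PowerSeries.constantCoeff (R := A)) with hQ
  have hXQ : (X : PowerSeries A) ∈ Q := by
    rw [hQ, Ideal.mem_comap, PowerSeries.constantCoeff_X]; exact 𝔮.asIdeal.zero_mem
  refine (Ideal.height_le_height_add_one_of_mem hXQ).trans ?_
  -- `A⟦X⟧/(X) ≃ A` carries `Q/(X)` to `𝔮`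
  let e : (PowerSeries A ⧸ Ideal.span {(X : PowerSeries A)}) ≃+* A :=
    (Ideal.quotEquivOfEq (ker_constantCoeff_eq_span_X (A := A)).symm).trans
      (RingHom.quotientKerEquivOfSurjective PowerSeries.constantCoeff_surj)
  have hcomp : (e : _ →+* A).comp (Ideal.Quotient.mk (Ideal.span {(X : PowerSeries A)})) =
      PowerSeries.constantCoeff (R := A) := by
    ext r
    simp [e]
  have hmap : (Q.map (Ideal.Quotient.mk (Ideal.span {(X : PowerSeries A)}))).map (e : _ →+* A) =
      𝔮.asIdeal := by
    rw [Ideal.map_map, hcomp, hQ, Ideal.map_comap_of_surjective _ PowerSeries.constantCoeff_surj]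
  have hh : (Q.map (Ideal.Quotient.mk (Ideal.span {(X : PowerSeries A)}))).height = 1 := by
    rw [← RingEquiv.height_map e, ← h𝔮]
    exact congrArg Ideal.height hmap
  rw [hh]
  exact le_of_eq (by norm_num)

/-- **The cyclic case.** For a nonzero prime `𝔭 ≠ (X)` of `A⟦X⟧` and a height-one prime `𝔮` of `A`:
`ℓ_𝔮((A⟦X⟧/𝔭)/X) = ℓ_𝔮((A⟦X⟧/𝔭)[X]) + ℓ_𝔮(A / char(A⟦X⟧/𝔭)(0))`. Cases: `X ∈ 𝔭` (then `ht 𝔭 ≥ 2`,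
`char = 1`, `X` acts by `0`); `X ∉ 𝔭` of height one (`char = 𝔭`, `(A⟦X⟧/𝔭)[X] = 0`,
`(A⟦X⟧/𝔭)/X ≅ A/𝔭(0)`); `X ∉ 𝔭` of height `≥ 2` (both sides vanish: a height-one `𝔮 ⊇ 𝔭(0)` would
give `𝔭 ⊊ {r : r(0) ∈ 𝔮}`, of height `≤ 2`). [folklore] -/
theorem lengthAt_cyclic (𝔭 : PrimeSpectrum (PowerSeries A)) (h0 : 𝔭.asIdeal ≠ ⊥)
    (hX : 𝔭.asIdeal ≠ Ideal.span {(X : PowerSeries A)}) (𝔮 : PrimeSpectrum A)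
    (h𝔮 : 𝔮.asIdeal.height = 1) :
    lengthAt A (QuotSMulTop (X : PowerSeries A) (PowerSeries A ⧸ 𝔭.asIdeal)) 𝔮 =
      lengthAt A (Submodule.torsionBy (PowerSeries A) (PowerSeries A ⧸ 𝔭.asIdeal)
          (X : PowerSeries A)) 𝔮 +
        lengthAt A (A ⧸ (charIdeal (PowerSeries A) (PowerSeries A ⧸ 𝔭.asIdeal)).map
          (PowerSeries.constantCoeff (R := A))) 𝔮 := by
  by_cases hXmem : (X : PowerSeries A) ∈ 𝔭.asIdeal
  · -- `X ∈ 𝔭`: `(X) < 𝔭`, so `ht 𝔭 ≥ 2` and `char(A⟦X⟧/𝔭) = 1`; `X` acts by zero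
    have hlt : Ideal.span {(X : PowerSeries A)} < 𝔭.asIdeal :=
      lt_of_le_of_ne ((Ideal.span_singleton_le_iff_mem _).mpr hXmem) (Ne.symm hX)
    haveI : (Ideal.span {(X : PowerSeries A)}).IsPrime := PowerSeries.span_X_isPrime
    have hht : 𝔭.asIdeal.height ≠ 1 := by
      have h := Ideal.height_strict_mono_of_isPrime_of_isPrime hlt
      rw [height_span_X] at h
      exact ne_of_gt h
    rw [charIdeal_quotient_prime_of_height_ne_one 𝔭 h0 hht, Ideal.one_eq_top, Ideal.map_top,
      lengthAt_quotient_top, add_zero]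
    have e₁ : QuotSMulTop (X : PowerSeries A) (PowerSeries A ⧸ 𝔭.asIdeal) ≃ₗ[A]
        (PowerSeries A ⧸ 𝔭.asIdeal) :=
      (Submodule.quotEquivOfEqBot _ (smul_top_quotient_eq_bot hXmem)).restrictScalars A
    have e₂ : Submodule.torsionBy (PowerSeries A) (PowerSeries A ⧸ 𝔭.asIdeal) (X : PowerSeries A)
        ≃ₗ[A] (PowerSeries A ⧸ 𝔭.asIdeal) :=
      ((LinearEquiv.ofEq _ _ (torsionBy_quotient_eq_top hXmem)).trans
        Submodule.topEquiv).restrictScalars A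
    rw [lengthAt_eq_of_linearEquiv e₁, lengthAt_eq_of_linearEquiv e₂]
  · -- `X ∉ 𝔭`: `(A⟦X⟧/𝔭)[X] = 0`, `(A⟦X⟧/𝔭)/X ≅ A/𝔭(0)`
    have hK : lengthAt A (Submodule.torsionBy (PowerSeries A) (PowerSeries A ⧸ 𝔭.asIdeal)
        (X : PowerSeries A)) 𝔮 = 0 := by
      haveI : Subsingleton (Submodule.torsionBy (PowerSeries A) (PowerSeries A ⧸ 𝔭.asIdeal)
          (X : PowerSeries A)) := by
        rw [torsionBy_quotient_eq_bot hXmem]; infer_instance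
      exact lengthAt_eq_zero_of_subsingleton 𝔮
    rw [hK, zero_add]
    obtain ⟨e⟩ := nonempty_quotSMulTop_quotient_linearEquiv (A := A) 𝔭.asIdeal
    rw [lengthAt_eq_of_linearEquiv e]
    by_cases hht : 𝔭.asIdeal.height = 1
    · rw [charIdeal_quotient_prime_of_height_eq_one 𝔭 hht]
    · rw [charIdeal_quotient_prime_of_height_ne_one 𝔭 h0 hht, Ideal.one_eq_top, Ideal.map_top,
        lengthAt_quotient_top]
      refine lengthAt_quotient_eq_zero_of_not_le fun hle => ?_
      set Q := 𝔮.asIdeal.comap (PowerSeries.constantCoeff (R := A)) with hQ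
      have h𝔭Q : 𝔭.asIdeal ≤ Q := Ideal.map_le_iff_le_comap.mp hle
      have hXQ : (X : PowerSeries A) ∈ Q := by
        rw [hQ, Ideal.mem_comap, PowerSeries.constantCoeff_X]; exact 𝔮.asIdeal.zero_mem
      have hlt : 𝔭.asIdeal < Q := lt_of_le_of_ne h𝔭Q fun h => hXmem (h ▸ hXQ)
      have h1 := Ideal.height_strict_mono_of_isPrime_of_isPrime hlt
      have h2 : 𝔭.asIdeal.height < 2 := lt_of_lt_of_le h1 (height_comap_constantCoeff_le 𝔮 h𝔮)
      obtain ⟨n, hn⟩ : ∃ n : ℕ, 𝔭.asIdeal.height = n :=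
        ⟨_, (ENat.coe_toNat (Ideal.height_ne_top_of_isPrime)).symm⟩
      rw [hn] at h2 hht
      have hn0 : n ≠ 0 := fun h => h0 (Ideal.height_eq_zero_iff_eq_bot.mp (by rw [hn, h]; rfl))
      have hn1 : n ≠ 1 := fun h => hht (by rw [h]; rfl)
      have : n < 2 := by exact_mod_cast h2
      omega

end Cyclic

/-! ### The principal characteristic ideal and its value at `X = 0` -/

section CharGen

variable [IsDomain A] [IsNoetherianRing A] [UniqueFactorizationMonoid (PowerSeries A)]
  {N : Type v} [AddCommGroup N] [Module (PowerSeries A) N]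

/-- For a module `N` over the factorial ring `A⟦X⟧` killed by some `s` with `s(0) ≠ 0`, the
characteristic ideal is principal with a generator `F` satisfying `F(0) ≠ 0` (otherwise
`char(N) ⊆ (X)` and `N_{(X)} ≠ 0`). [folklore] -/
theorem exists_charIdeal_eq_span {s : PowerSeries A} (hs0 : PowerSeries.constantCoeff s ≠ 0)
    (hs : ∀ m : N, s • m = 0) :
    ∃ F : PowerSeries A, charIdeal (PowerSeries A) N = Ideal.span {F} ∧
      PowerSeries.constantCoeff F ≠ 0 := by
  obtain ⟨F, hF⟩ :=
    (isPrincipal_charIdeal_of_ufm (R := PowerSeries A) (M := N)).principal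
  refine ⟨F, hF, fun hc => ?_⟩
  let PX : PrimeSpectrum (PowerSeries A) := ⟨Ideal.span {X}, PowerSeries.span_X_isPrime⟩
  have hle : charIdeal (PowerSeries A) N ≤ PX.asIdeal := by
    rw [hF]; exact (Ideal.span_singleton_le_iff_mem _).mpr (mem_span_X_iff.mpr hc)
  refine lengthAt_ne_zero_of_charIdeal_le (𝔮 := PX) height_span_X hle ?_
  exact lengthAt_eq_zero_of_isTorsionBy (s := s) (fun m => hs m) PX
    (fun h => hs0 (mem_span_X_iff.mp h))

/-- **Additivity of `ℓ_𝔮(A / char(·)(0))`** along a short exact sequence `0 → N₁ → N₂ → N₃ → 0` with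
`N₂` finitely generated and killed by some `s` with `s(0) ≠ 0`: the characteristic ideal is
multiplicative (Bourbaki AC VII §4.5 Prop. 10, tree `charIdeal_eq_mul_of_exact`), the generators have
nonzero constant terms, and `ℓ_𝔮(A/(ab)) = ℓ_𝔮(A/(a)) + ℓ_𝔮(A/(b))`. [folklore] -/
theorem lengthAt_quotient_map_charIdeal_eq_add {N₁ N₂ N₃ : Type*}
    [AddCommGroup N₁] [Module (PowerSeries A) N₁] [AddCommGroup N₂] [Module (PowerSeries A) N₂]
    [AddCommGroup N₃] [Module (PowerSeries A) N₃] [Module.Finite (PowerSeries A) N₂]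
    (f : N₁ →ₗ[PowerSeries A] N₂) (g : N₂ →ₗ[PowerSeries A] N₃) (hf : Injective f)
    (hg : Surjective g) (hfg : Exact f g) {s : PowerSeries A}
    (hs0 : PowerSeries.constantCoeff s ≠ 0) (hs : ∀ m : N₂, s • m = 0) (𝔮 : PrimeSpectrum A) :
    lengthAt A (A ⧸ (charIdeal (PowerSeries A) N₂).map (PowerSeries.constantCoeff (R := A))) 𝔮 =
      lengthAt A (A ⧸ (charIdeal (PowerSeries A) N₁).map (PowerSeries.constantCoeff (R := A))) 𝔮 +
      lengthAt A (A ⧸ (charIdeal (PowerSeries A) N₃).map (PowerSeries.constantCoeff (R := A))) 𝔮 := by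
  have hs₁ : ∀ m : N₁, s • m = 0 := fun m => hf (by rw [map_smul, hs, map_zero])
  have hs₃ : ∀ m : N₃, s • m = 0 := fun m => by
    obtain ⟨n, rfl⟩ := hg m; rw [← map_smul, hs, map_zero]
  have hsne : s ≠ 0 := fun h => hs0 (by rw [h, map_zero])
  have hN₂ : Module.IsTorsion (PowerSeries A) N₂ := fun m =>
    ⟨⟨s, mem_nonZeroDivisors_of_ne_zero hsne⟩, hs m⟩
  obtain ⟨F₁, hF₁, hF₁0⟩ := exists_charIdeal_eq_span (N := N₁) hs0 hs₁
  obtain ⟨F₃, hF₃, hF₃0⟩ := exists_charIdeal_eq_span (N := N₃) hs0 hs₃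
  have hmul := charIdeal_eq_mul_of_exact hN₂ f g hf hg hfg
  have e₂ : (charIdeal (PowerSeries A) N₂).map (PowerSeries.constantCoeff (R := A)) =
      Ideal.span {PowerSeries.constantCoeff F₁ * PowerSeries.constantCoeff F₃} := by
    rw [hmul, Ideal.map_mul, hF₁, hF₃, Ideal.map_span, Set.image_singleton, Ideal.map_span,
      Set.image_singleton, Ideal.span_singleton_mul_span_singleton]
  have e₁ : (charIdeal (PowerSeries A) N₁).map (PowerSeries.constantCoeff (R := A)) =
      Ideal.span {PowerSeries.constantCoeff F₁} := by rw [hF₁, Ideal.map_span, Set.image_singleton]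
  have e₃ : (charIdeal (PowerSeries A) N₃).map (PowerSeries.constantCoeff (R := A)) =
      Ideal.span {PowerSeries.constantCoeff F₃} := by rw [hF₃, Ideal.map_span, Set.image_singleton]
  rw [lengthAt_quotient_congr e₂, lengthAt_quotient_congr e₁, lengthAt_quotient_congr e₃,
    lengthAt_quotient_span_singleton_mul _ hF₁0]

end CharGen

end PowerSeriesSpecialization

end Summit.BirchSwinnertonDyer.BirchSwinnertonDyer.Theorems.SignedBaseChangeAcDivSpecialization

end
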